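import Summits.BirchSwinnertonDyer.Rank1Residual.AdditivePotMult.RankZeroTwistHeights
import Literature.NumberTheory.EllipticCurves.BSDQuadraticDescentShaOddPartGeneralProofs
import Literature.NumberTheory.EllipticCurves.BSDQuadraticDescentTorsionOddPartProofs
import Literature.NumberTheory.EllipticCurves.HeegnerPointsKolyvaginExceptionalTwistProofs
import Literature.NumberTheory.EllipticCurves.BSDInvariantsProofs
import Literature.NumberTheory.EllipticCurves.QuadraticTwistRank
import Literature.NumberTheory.EllipticCurves.RegulatorProofs
import Literature.NumberTheory.EllipticCurves.MordellWeilTheoremProofs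
import HarnessLib

/-!
# Milne's quotient in TOTAL RANK ONE, part 1: the regulator comparison
# `m · Reg(E_K) = 2 · Reg(E) · Reg(E^{(d_K)})`, `m ∈ {1, 4}`, and the odd parts of torsion and `Ш`
# in any rank (row T-MIL-R1, FILE E-1; seat n1011-p01 GEN 7)

HONEST FRAMING (cell `b2b-bsdres`, run/shared/lean/b2b/bsd-rank1-residual/, verbatim in every
file): the goal of the cell is to DELETE the COMBINATION-SHAPED residual classes of the
Birch–Swinnerton-Dyer formula for ALL analytic-rank `≤ 1` elliptic curves over `ℚ` — "full BSD
formula for every rank `≤ 1` curve in class `C`" assembled STRICTLY from published theorems — so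
that the rank-`≤ 1` remainder becomes exactly the CONSTRUCTION-SHAPED classes, which are TYPED
(missing-input `Prop`s), NOT attempted. This is not "finishing BSD". Sub-classes X3♯(M) / X4(M)
(additive, potentially multiplicative prime; base-change-and-descend): a RESEARCH ROUTE; they stay
CONSTRUCTION-SHAPED; nothing is booked by this file; no mark / label moved. THEOREMS ONLY: no
definition, no named fact, no `sorry`.

## What (row T-MIL-R1 = D-4 of T-MIL-SHA, `cells/n1011/skel/T-MIL-R1.md` §2, FILE E-1)

Row T-MIL-ODD / FILE C-4a reduced the `ord_p`-shaped Milne binder `hWR_p` of the cell's descent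
consumers to the odd Tamagawa identity in RANK ZERO over `K` (all regulators `1`, `#tors = #E`).
For the cell's headline population — `r_an(E) = 1` — the base change `E_K` has rank ONE
(`rank E(K) = rank E(ℚ) + rank E^{(d_K)}(ℚ)`, the twist chosen of rank `0`), and Milne's quotient
carries the REGULATOR ratio `Reg(E_K)/(Reg(E)·Reg(E^{(d)}))` and the torsion ratio with infinite
Mordell–Weil groups. This file supplies the three rank-one / any-rank comparisons, ALL ASSEMBLED
FROM TREE THEOREMS (no new height theory):

* `exists_mul_regulator_baseChange_quadratic_of_rank_add_eq_one` — **for `rank W(ℚ) + rank Wd(ℚ) = 1`: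
  `∃ m ∈ {1, 4}, m · Reg(W') = 2 · Reg(W) · Reg(Wd)`** (`Wd` any `ℚ`-model of `W^{(d_K)}`, `W'`
  any `K`-model of `W_K`, `K` any quadratic field). Case `(1, 0)`: Kriz–Li's height–index
  relation `exists_mul_canonicalHeight_eq_index_sq_mul_regulator` (`m·#E(K)_tors²·ĥ_K(P) =
  2·[E(K):ℤP]²·Reg(E/ℚ)`) at a generator `P = g_K` of `E(K)/tors`
  (`exists_generator_regulator_eq_of_mordellWeilRank_eq_one`: `Reg(E_K) = ĥ_K(g_K)`;
  `index_zmultiples_eq`: `[E(K):ℤg_K] = #E(K)_tors`), and `Reg(Wd) = 1`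
  (`regulator_eq_one_of_rank_zero`); case `(0, 1)`: the `σ = −1` twin
  `exists_mul_canonicalHeight_eq_index_sq_mul_regulator_twist` (seat additive-p1,
  `RankZeroTwistHeights`) and `Reg(W) = 1`. (Gross–Zagier 1986 V.§2 p. 311; Jetchev–Skinner–Wan
  2017 §7.4.1: "`Reg(E/K) = Reg(E/ℚ)` up to `p`-units".)
* `padicValNat_torsionOrder_baseChange_quadratic_of_odd` — **`v_p(#W'(K)_tors) = v_p(#W(ℚ)_tors) +
  v_p(#Wd(ℚ)_tors)` at every odd `p`, ANY rank** (`E(K)[p^∞] ≅ E(ℚ)[p^∞] × E^{(d)}(ℚ)[p^∞]`,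
  tree `card_primaryComponent_point_baseChange_quadratic_of_odd`, Silverman Ex. 10.16, read on
  the finite torsion subgroups, `natCard_primaryComponent_eq_pow_padicValNat_torsion`).
* `padicValNat_shaOrder_baseChange_quadratic_of_odd_of_finite` — **`v_p(#Ш(W')) = v_p(#Ш(W)) +
  v_p(#Ш(Wd))` at odd `p`, ANY rank**, from `card_primaryComponent_sha_baseChange_quadratic_of_odd_of_finite`
  (Jetchev–Skinner–Wan §7.4.1) and `Ш(W')` finite (`shaFinite_baseChange_of_shaFinite`).

FILE E-2 (`QuadraticBaseChangeMilneQuotientRankOne`) turns these into `hWR_p` in total rank one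
and the A65-FREE descent ENDs for rank-one X3♯(M)/X4(M) pairs with a rank-zero twist.
HONEST LIMITS: total rank `≥ 2` is NOT treated (it needs the Gram-determinant form of the
comparison); the models are arbitrary but the statements are up to the sign-free factor `m`
(`1` or `4`, not determined here); TOOL theorems; closes no class; moves no mark; no named fact.

References: B. Gross, D. Zagier, Invent. Math. 84 (1986) V.§2 [GrossZagier1986]; D. Jetchev,
C. Skinner, X. Wan, Camb. J. Math. 5 (2017) §7.4.1 [JetchevSkinnerWan2017]; J. H. Silverman,
*AEC* 2nd ed., VIII.9, Exercise 10.16 [SilvermanAEC2009]; D. Kriz, C. Li, Forum Math. Sigma 7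
(2019) §2 (shape) [KrizLi2019].
-/

noncomputable section

open scoped Classical

namespace Summit.BirchSwinnertonDyer.Rank1Residual.AdditivePotMult

open WeierstrassCurve Literature.NumberTheory.EllipticCurves
  Literature.NumberTheory.EllipticCurves.KrizLi2019 Literature.NumberTheory.QuadraticFields

/-! ## §1 The raw triple `W`, `W^{(c)}`, `W_K` (`K = ℚ(θ)`, `θ² = c`) -/

section Raw

variable (W : WeierstrassCurve ℚ) [W.IsElliptic] (K : Type) [Field K] [NumberField K]
  (h2 : Module.finrank ℚ K = 2) {θ : K} {c : ℚ} (hθ : θ ∉ Set.range (algebraMap ℚ K))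
  (hc : θ ^ 2 = algebraMap ℚ K c)

include h2 hθ hc in
/-- **`rank W(K) = rank W(ℚ) + rank W^{(c)}(ℚ)`** for `K = ℚ(θ)`, `θ² = c` (tree
`mordellWeilRank_baseChange_of_finrank_eq_two_of_finite` with `W^{(d_K)} ≅ W^{(c)}`, `d_K = c q²`;
Mordell–Weil over `K` makes the ranks genuine). [cite: SilvermanAEC2009, Exercise 10.16] -/
theorem mordellWeilRank_baseChange_eq_add_of_sq [(W.quadraticTwist c).IsElliptic] :
    (W.baseChange K).mordellWeilRank = W.mordellWeilRank + (W.quadraticTwist c).mordellWeilRank := by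
  haveI : (W.baseChange K).IsElliptic := isElliptic_baseChange' W K
  haveI : Module.Finite ℤ (W.baseChange K).toAffine.Point := (W.baseChange K).module_finite_point_holds
  obtain ⟨q, hq, hd⟩ := NumberField.exists_discr_eq_mul_sq h2 hθ hc
  obtain ⟨C₁, hC₁⟩ := W.exists_variableChange_quadraticTwist_mul_sq c q hq
  rw [← hd] at hC₁
  rw [W.mordellWeilRank_baseChange_of_finrank_eq_two_of_finite K h2, ← hC₁,
    mordellWeilRank_variableChange_holds]

include h2 hθ hc in
/-- **Case `(1, 0)`: `m · Reg(W_K) = 2 · Reg(W) · Reg(W^{(c)})`, `m ∈ {1, 4}`**, when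
`rank W(ℚ) = 1`, `rank W^{(c)}(ℚ) = 0`: Kriz–Li's height–index relation at a generator `g_K` of
`W(K)/tors` (`[W(K):ℤg_K] = #W(K)_tors`, `Reg(W_K) = ĥ_K(g_K)`), and `Reg(W^{(c)}) = 1`.
[cite: GrossZagier1986, V.§2 (p. 311)] [cite: JetchevSkinnerWan2017, §7.4.1] -/
theorem exists_mul_regulator_baseChange_eq_of_rank_one_zero [(W.quadraticTwist c).IsElliptic]
    (hrQ : W.mordellWeilRank = 1) (hrc : (W.quadraticTwist c).mordellWeilRank = 0) :
    ∃ m : ℕ, (m = 1 ∨ m = 4) ∧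
      (m : ℝ) * (W.baseChange K).regulator = 2 * W.regulator * (W.quadraticTwist c).regulator := by
  haveI : (W.baseChange K).IsElliptic := isElliptic_baseChange' W K
  have hrK : (W.baseChange K).mordellWeilRank = 1 := by
    rw [mordellWeilRank_baseChange_eq_add_of_sq W K h2 hθ hc, hrQ, hrc]
  obtain ⟨gK, hgK, hgenK, -, hregK⟩ :=
    exists_generator_regulator_eq_of_mordellWeilRank_eq_one (W.baseChange K) hrK
  obtain ⟨m, hm, hid⟩ := exists_mul_canonicalHeight_eq_index_sq_mul_regulator W K h2 hrK hrQ gK hgK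
  have hidx : (AddSubgroup.zmultiples gK).index = (W.baseChange K).torsionOrder := by
    have h := index_zmultiples_eq (W.baseChange K) hgK hgenK (n := 1) one_ne_zero (x := gK)
      (by rw [one_zsmul, sub_self]; exact zero_mem _)
    rw [h, Int.natAbs_one, one_mul]
  have hT : ((W.baseChange K).torsionOrder : ℝ) ≠ 0 := by
    exact_mod_cast ((W.baseChange K).torsionOrder_pos_holds).ne'
  refine ⟨m, hm, ?_⟩
  rw [hidx] at hid
  rw [hregK, (W.quadraticTwist c).regulator_eq_one_of_rank_zero hrc, mul_one]
  have h0 : ((W.baseChange K).torsionOrder : ℝ) ^ 2 *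
      ((m : ℝ) * gK.canonicalHeight - 2 * W.regulator) = 0 := by
    linear_combination hid
  rcases mul_eq_zero.mp h0 with h | h
  · exact absurd h (pow_ne_zero 2 hT)
  · exact sub_eq_zero.mp h

include h2 hθ hc in
/-- **Case `(0, 1)`: `m · Reg(W_K) = 2 · Reg(W) · Reg(W^{(c)})`, `m ∈ {1, 4}`**, when
`rank W(ℚ) = 0`, `rank W^{(c)}(ℚ) = 1`: the `σ = −1` twin of the height–index relation
(`exists_mul_canonicalHeight_eq_index_sq_mul_regulator_twist`, seat additive-p1) at a generator of
`W(K)/tors`, and `Reg(W) = 1`. [cite: GrossZagier1986, V.§2 (p. 311)] [cite: SilvermanAEC2009, Exercise 10.16] -/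
theorem exists_mul_regulator_baseChange_eq_of_rank_zero_one [(W.quadraticTwist c).IsElliptic]
    (hrQ : W.mordellWeilRank = 0) (hrc : (W.quadraticTwist c).mordellWeilRank = 1) :
    ∃ m : ℕ, (m = 1 ∨ m = 4) ∧
      (m : ℝ) * (W.baseChange K).regulator = 2 * W.regulator * (W.quadraticTwist c).regulator := by
  haveI : (W.baseChange K).IsElliptic := isElliptic_baseChange' W K
  have hrK : (W.baseChange K).mordellWeilRank = 1 := by
    rw [mordellWeilRank_baseChange_eq_add_of_sq W K h2 hθ hc, hrQ, hrc]
  obtain ⟨gK, hgK, hgenK, -, hregK⟩ :=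
    exists_generator_regulator_eq_of_mordellWeilRank_eq_one (W.baseChange K) hrK
  obtain ⟨m, hm, hid⟩ :=
    exists_mul_canonicalHeight_eq_index_sq_mul_regulator_twist W K h2 hθ hc hrK hrQ hrc gK hgK
  have hidx : (AddSubgroup.zmultiples gK).index = (W.baseChange K).torsionOrder := by
    have h := index_zmultiples_eq (W.baseChange K) hgK hgenK (n := 1) one_ne_zero (x := gK)
      (by rw [one_zsmul, sub_self]; exact zero_mem _)
    rw [h, Int.natAbs_one, one_mul]
  have hT : ((W.baseChange K).torsionOrder : ℝ) ≠ 0 := by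
    exact_mod_cast ((W.baseChange K).torsionOrder_pos_holds).ne'
  refine ⟨m, hm, ?_⟩
  rw [hidx] at hid
  rw [hregK, W.regulator_eq_one_of_rank_zero hrQ, mul_one]
  have h0 : ((W.baseChange K).torsionOrder : ℝ) ^ 2 *
      ((m : ℝ) * gK.canonicalHeight - 2 * (W.quadraticTwist c).regulator) = 0 := by
    linear_combination hid
  rcases mul_eq_zero.mp h0 with h | h
  · exact absurd h (pow_ne_zero 2 hT)
  · exact sub_eq_zero.mp h

end Raw

/-! ## §2 Arbitrary models `Wd ≅ W^{(d_K)}`, `W' ≅ W_K` -/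

section Models

variable (W : WeierstrassCurve ℚ) [W.IsElliptic] (K : Type) [Field K] [NumberField K]
  (h2 : Module.finrank ℚ K = 2) (Wd : WeierstrassCurve ℚ) [Wd.IsElliptic]
  (hWd : ∃ C : VariableChange ℚ, C • W.quadraticTwist (NumberField.discr K : ℚ) = Wd)
  (W' : WeierstrassCurve K) [W'.IsElliptic] (hW' : ∃ C : VariableChange K, C • W.baseChange K = W')

include h2 hWd hW' in
/-- **THE REGULATOR COMPARISON IN TOTAL RANK ONE.** Let `W/ℚ` be elliptic, `K` a quadratic field
(either signature), `Wd` any `ℚ`-model of the twist `W^{(d_K)}`, `W'` any `K`-model of `W_K`, with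
`rank W(ℚ) + rank Wd(ℚ) = 1`. Then `m · Reg(W'/K) = 2 · Reg(W/ℚ) · Reg(Wd/ℚ)` for some `m ∈ {1, 4}`
(so the regulator ratio of Milne's quotient is `2/m ∈ {2, 1/2}`, a `p`-adic unit for odd `p`).
Cases `(1,0)` / `(0,1)` by `exists_mul_regulator_baseChange_eq_of_rank_one_zero` /
`…_of_rank_zero_one`; models by `regulator_variableChange_holds`,
`mordellWeilRank_variableChange_holds`, `W^{(d_K)} ≅ W^{(c)}` (`d_K = c q²`).
[cite: GrossZagier1986, V.§2 (p. 311)] [cite: JetchevSkinnerWan2017, §7.4.1] -/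
theorem exists_mul_regulator_baseChange_quadratic_of_rank_add_eq_one
    (hr : W.mordellWeilRank + Wd.mordellWeilRank = 1) :
    ∃ m : ℕ, (m = 1 ∨ m = 4) ∧ (m : ℝ) * W'.regulator = 2 * W.regulator * Wd.regulator := by
  obtain ⟨θ, c, hθ, hc⟩ := Quadratic.exists_sq_eq_algebraMap (F := ℚ) (K := K) h2
  obtain ⟨q, hq, hd⟩ := NumberField.exists_discr_eq_mul_sq h2 hθ hc
  obtain ⟨C₁, hC₁⟩ := W.exists_variableChange_quadraticTwist_mul_sq c q hq
  rw [← hd] at hC₁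
  obtain ⟨Cd, hCd⟩ := hWd
  obtain ⟨C', hC'⟩ := hW'
  subst hCd hC'
  have hc0 : c ≠ 0 := by
    rintro rfl
    apply Quadratic.ne_zero_of_not_mem_range hθ
    have : θ ^ 2 = 0 := by rw [hc, map_zero]
    exact pow_eq_zero_iff (n := 2) (by norm_num) |>.mp this
  haveI : (W.quadraticTwist c).IsElliptic := W.isElliptic_quadraticTwist hc0
  have hD : (NumberField.discr K : ℚ) ≠ 0 := by exact_mod_cast NumberField.discr_ne_zero K
  haveI : (W.quadraticTwist (NumberField.discr K : ℚ)).IsElliptic := W.isElliptic_quadraticTwist hD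
  haveI : (W.baseChange K).IsElliptic := isElliptic_baseChange' W K
  -- the models have the regulators and ranks of the raw curves
  have hregd : (Cd • W.quadraticTwist (NumberField.discr K : ℚ)).regulator =
      (W.quadraticTwist c).regulator := by
    rw [regulator_variableChange_holds, ← hC₁, regulator_variableChange_holds]
  have hrkd : (Cd • W.quadraticTwist (NumberField.discr K : ℚ)).mordellWeilRank =
      (W.quadraticTwist c).mordellWeilRank := by
    rw [mordellWeilRank_variableChange_holds, ← hC₁, mordellWeilRank_variableChange_holds]
  have hreg' : (C' • W.baseChange K).regulator = (W.baseChange K).regulator :=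
    regulator_variableChange_holds _ C'
  rw [hregd, hreg']
  rw [hrkd] at hr
  rcases Nat.eq_zero_or_pos W.mordellWeilRank with h0 | hpos
  · rw [h0, zero_add] at hr
    exact exists_mul_regulator_baseChange_eq_of_rank_zero_one W K h2 hθ hc h0 hr
  · have hle : W.mordellWeilRank ≤ 1 := hr ▸ Nat.le_add_right _ _
    have h1 : W.mordellWeilRank = 1 := le_antisymm hle hpos
    have h0 : (W.quadraticTwist c).mordellWeilRank = 0 := by
      rw [h1] at hr
      exact Nat.add_left_cancel (hr.trans (add_zero 1).symm)
    exact exists_mul_regulator_baseChange_eq_of_rank_one_zero W K h2 hθ hc h1 h0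

include h2 hWd hW' in
/-- **The regulator comparison in total rank AT MOST one**: `m · Reg(W') = 2 · Reg(W) · Reg(Wd)`
with `m ∈ {1, 2, 4}` — in total rank `0` all three regulators are `1` (`regulator_eq_one_of_rank_zero`;
`rank W'(K) = rank W(ℚ) + rank Wd(ℚ) = 0`) and `m = 2`; in total rank `1` this is
`exists_mul_regulator_baseChange_quadratic_of_rank_add_eq_one`. In every case `m` is a unit at
every odd prime. [cite: GrossZagier1986, V.§2 (p. 311)] [cite: SilvermanAEC2009, Exercise 10.16] -/
theorem exists_mul_regulator_baseChange_quadratic_of_rank_add_le_one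
    (hr : W.mordellWeilRank + Wd.mordellWeilRank ≤ 1) :
    ∃ m : ℕ, (m = 1 ∨ m = 2 ∨ m = 4) ∧ (m : ℝ) * W'.regulator = 2 * W.regulator * Wd.regulator := by
  rcases Nat.eq_zero_or_pos (W.mordellWeilRank + Wd.mordellWeilRank) with h0 | hpos
  · -- total rank zero: all regulators are `1`
    have hW0 : W.mordellWeilRank = 0 := Nat.eq_zero_of_add_eq_zero_right h0
    have hd0 : Wd.mordellWeilRank = 0 := Nat.eq_zero_of_add_eq_zero_left h0
    obtain ⟨θ, c, hθ, hc⟩ := Quadratic.exists_sq_eq_algebraMap (F := ℚ) (K := K) h2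
    obtain ⟨q, hq, hd⟩ := NumberField.exists_discr_eq_mul_sq h2 hθ hc
    obtain ⟨C₁, hC₁⟩ := W.exists_variableChange_quadraticTwist_mul_sq c q hq
    rw [← hd] at hC₁
    obtain ⟨Cd, hCd⟩ := hWd
    obtain ⟨C', hC'⟩ := hW'
    have hc0 : c ≠ 0 := by
      rintro rfl
      apply Quadratic.ne_zero_of_not_mem_range hθ
      have : θ ^ 2 = 0 := by rw [hc, map_zero]
      exact pow_eq_zero_iff (n := 2) (by norm_num) |>.mp this
    haveI : (W.quadraticTwist c).IsElliptic := W.isElliptic_quadraticTwist hc0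
    haveI : (W.baseChange K).IsElliptic := isElliptic_baseChange' W K
    have hc' : (W.quadraticTwist c).mordellWeilRank = 0 := by
      rw [← mordellWeilRank_variableChange_holds _ C₁, hC₁, ← mordellWeilRank_variableChange_holds _ Cd,
        hCd, hd0]
    have hK0 : W'.mordellWeilRank = 0 := by
      rw [← hC', mordellWeilRank_variableChange_holds, mordellWeilRank_baseChange_eq_add_of_sq W K h2 hθ hc,
        hW0, hc', add_zero]
    refine ⟨2, Or.inr (Or.inl rfl), ?_⟩
    rw [W'.regulator_eq_one_of_rank_zero hK0, W.regulator_eq_one_of_rank_zero hW0,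
      Wd.regulator_eq_one_of_rank_zero hd0]
    norm_num
  · have h1 : W.mordellWeilRank + Wd.mordellWeilRank = 1 := le_antisymm hr hpos
    obtain ⟨m, hm, h⟩ :=
      exists_mul_regulator_baseChange_quadratic_of_rank_add_eq_one W K h2 Wd hWd W' hW' h1
    exact ⟨m, hm.elim Or.inl (fun h4 => Or.inr (Or.inr h4)), h⟩

include h2 hWd hW' in
/-- **The odd part of the torsion under quadratic base change, ANY rank:** for every odd prime `p`,
`v_p(#W'(K)_tors) = v_p(#W(ℚ)_tors) + v_p(#Wd(ℚ)_tors)` (`W'`, `Wd` arbitrary models). Tree: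
`card_primaryComponent_point_baseChange_quadratic_of_odd` (`#X(·)[p^∞]` multiplicative, Silverman
*AEC* Exercise 10.16) read on the finite torsion subgroups
(`natCard_primaryComponent_eq_pow_padicValNat_torsion`). [cite: SilvermanAEC2009, Exercise 10.16] -/
theorem padicValNat_torsionOrder_baseChange_quadratic_of_odd (p : ℕ) [Fact p.Prime] (hp2 : p ≠ 2) :
    padicValNat p W'.torsionOrder = padicValNat p W.torsionOrder + padicValNat p Wd.torsionOrder := by
  haveI : NeZero (2 : ℚ) := ⟨two_ne_zero⟩
  obtain ⟨θ, c, hθ, hc⟩ := Quadratic.exists_sq_eq_algebraMap (F := ℚ) (K := K) h2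
  obtain ⟨q, hq, hd⟩ := NumberField.exists_discr_eq_mul_sq h2 hθ hc
  haveI := W'.finite_torsion_holds
  have hcard := card_primaryComponent_point_baseChange_quadratic_of_odd W h2 hθ hc hq hd hWd hW' p hp2
  -- the point groups over `ℚ` carry the (classical) instances of the tree lemma: feed the
  -- finiteness of their torsion subgroups explicitly rather than by instance search
  rw [natCard_primaryComponent_eq_pow_padicValNat_torsion p,
    @natCard_primaryComponent_eq_pow_padicValNat_torsion _ (_) p _ W.finite_torsion_holds,
    @natCard_primaryComponent_eq_pow_padicValNat_torsion _ (_) p _ Wd.finite_torsion_holds,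
    ← pow_add] at hcard
  exact Nat.pow_right_injective (Fact.out : p.Prime).two_le hcard

include h2 hWd hW' in
/-- **The odd part of `Ш` under quadratic base change, ANY rank, in valuations:** for every odd
prime `p`, with `Ш(W/ℚ)` and `Ш(Wd/ℚ)` finite (hence `Ш(W'/K)` finite,
`shaFinite_baseChange_of_shaFinite`): `v_p(#Ш(W')) = v_p(#Ш(W)) + v_p(#Ш(Wd))`. Tree:
`card_primaryComponent_sha_baseChange_quadratic_of_odd_of_finite` (Jetchev–Skinner–Wan 2017 §7.4.1,
Dokchitser–Dokchitser 2010 Lemma 4.14). [cite: JetchevSkinnerWan2017, §7.4.1 (arXiv:1512.06894 p. 30)] -/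
theorem padicValNat_shaOrder_baseChange_quadratic_of_odd_of_finite [Finite W.sha] [Finite Wd.sha]
    (p : ℕ) [Fact p.Prime] (hp2 : p ≠ 2) :
    padicValNat p W'.shaOrder = padicValNat p W.shaOrder + padicValNat p Wd.shaOrder := by
  haveI : Finite W'.sha := by
    obtain ⟨Cd, hCd⟩ := hWd
    obtain ⟨C', hC'⟩ := hW'
    have hd : (W.quadraticTwist (NumberField.discr K : ℚ)).ShaFinite :=
      (shaFinite_variableChange_iff_holds _ Cd).mp (by rw [hCd]; exact ‹Finite Wd.sha›)
    have hK : (W.baseChange K).ShaFinite := shaFinite_baseChange_of_shaFinite W K h2 ‹Finite W.sha› hd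
    have h' : W'.ShaFinite := by rw [← hC']; exact (shaFinite_variableChange_iff_holds _ C').mpr hK
    exact h'
  exact padicValNat_natCard_eq_add_of_primaryComponent p
    (card_primaryComponent_sha_baseChange_quadratic_of_odd_of_finite W K h2 Wd hWd W' hW' p hp2)

end Models

end Summit.BirchSwinnertonDyer.Rank1Residual.AdditivePotMult

end
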